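import Literature.Computability.AlgebraicComplexity.AlmanLi2026OneFunctionalSpeedup
import Literature.Computability.AlgebraicComplexity.DegenerationDirectSum
import Literature.Computability.AlgebraicComplexity.TensorSemiring
import HarnessLib

/-!
# Appending a direct sum of slices: Thm. 6.3 of Alman–Li 2026 in the `λ`-free case (first proof)

Topic `Literature/Computability/AlgebraicComplexity` (family `MatrixMultiplication`). Source: J. Alman,
B. Li, *Asymptotic Rank Speedup Theorems, Revisited*, arXiv:2605.21738 (2026), §6, Thm. 6.3 and its
first proof (held text `paper:arxiv-2605.21738`, p0015 L102–111, p0016 L1–10):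
"Theorem 6.3. Let `T ⊴ ⟨r⟩`, and let `{aᵢ}, {bᵢ}, {cᵢ}` be `𝔽(λ)`-vectors representing the
degeneration. Suppose there exist nonzero scalars `c'ᵢ` and a partition of `[r]` into `p` groups
`[r] = I₁ ⊔ ⋯ ⊔ I_p`. For each `1 ≤ α ≤ p`, let `r_α = |I_α|`, let `M_α = ∑_{i∈I_α} aᵢbᵢc'ᵢ`, and let
`s_α ≥ R(M_α)`. If `r_α + s_α ≥ 2n` for all `α`, then
`T ⊕ ⊕_α ⟨1, r_α + s_α − 2n, 1⟩ ⊴ ⟨r⟩ ⊕ ⊕_α ⟨1, s_α, 1⟩`. … *First proof.* In the spirit of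
(cor:freelunch_speedup_degen), it suffices to prove the restriction case, i.e., working over `𝔽`
instead of `𝔽(λ)`. In that setting, we can write `T` as a sum of tensors `T = ∑_α T_α`, where
`T_α = ∑_{i∈I_α} aᵢbᵢcᵢ`. Then `R(T_α) ≤ r_α`. We can apply (thm:app-oneslice) to each `T_α`
individually and sum the results … The conclusion follows from `T ≤ ⊕_α T_α`."

## What is formalised (everything PROVED; no definitions, no named facts)

* (private) `tensorRestrictsTo_directSum_add` — "`T₁ + T₂ ≤ T₁ ⊕ T₂`" (the last sentence of the proof);
  `AlmanLi2026.algDegeneratesTo_add_of_directSum` — the combination step "apply … to each `T_α`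
  individually and sum the results" (`⟨r₁⟩⊕X₁ ⊵ T₁⊕Y₁`, `⟨r₂⟩⊕X₂ ⊵ T₂⊕Y₂` ⟹
  `⟨r₁+r₂⟩⊕(X₁⊕X₂) ⊵ (T₁+T₂)⊕(Y₁⊕Y₂)`).
* **`AlmanLi2026.thm63_rankDecomposition_two`** — Thm. 6.3 in the restriction (`λ`-free) case for a
  partition into TWO groups, indexed by a sum type `σ₁ ⊕ σ₂`: for `T = ∑_{i} aᵢ ⊗ bᵢ ⊗ cᵢ`
  (`n = |ι'|`, `m = |κ'|`), nonzero `c'ᵢ`, and `s_α ≥ rank M_α`: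
  `⟨|σ₁|+|σ₂|⟩ ⊕ (⟨s₁-slice⟩ ⊕ ⟨s₂-slice⟩) ⊵ T ⊕ (⟨(|σ₁|+s₁−(n+m))-slice⟩ ⊕ ⟨(|σ₂|+s₂−(n+m))-slice⟩)`
  (slices with trivial factor third; truncated subtraction), exactly by the printed first proof:
  Thm. 6.1 (`AlmanLi2026.thm61_rankDecomposition_fintype`) for `T₁`, `T₂`, the direct sum of the two
  degenerations (`AlgDegeneratesTo.directSum`, BCS (15.25)), the relabellings
  `(⟨r₁⟩⊕X)⊕(⟨r₂⟩⊕Y) ≅ ⟨r₁+r₂⟩⊕(X⊕Y)` (computed in the tree's semiring `TensorClass K`), and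
  `T ≤ T₁ ⊕ T₂`.  More groups: iterate (`σ₂` may itself be a sum type).
  -- TODO(general form): border-rank (`𝔽(λ)`-)data, i.e. `T ⊴ ⟨r⟩` instead of a rank decomposition
  -- (the tree's bootstrapping `AlmanLi2026Bootstrap` does this for `cw_q` in `AlmanLi2026CWPowerSpeedup`).

## References

* J. Alman, B. Li, *Asymptotic Rank Speedup Theorems, Revisited*, arXiv:2605.21738 (2026), Thm. 6.3
  (p0015–p0016). [AlmanLi2026]
* P. Bürgisser, M. Clausen, M. A. Shokrollahi, *Algebraic Complexity Theory* (1997), Prop. (15.25)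
  (degeneration is compatible with `⊕`). [BurgisserClausenShokrollahi1997]
-/

noncomputable section

open scoped BigOperators

namespace Literature.Computability.AlgebraicComplexity

section SumLeDirectSum

variable {K : Type} [CommSemiring K] {ι κ μ : Type} [Fintype ι] [Fintype κ] [Fintype μ]
  [DecidableEq ι] [DecidableEq κ] [DecidableEq μ]

/-- **`T₁ + T₂ ≤ T₁ ⊕ T₂`**: the sum of two tensors of the same format is a restriction of their
direct sum (fold the two copies of each index set; "The conclusion follows from `T ≤ ⊕_α T_α`").
[cite: AlmanLi2026, Thm. 6.3 (first proof)]
(Private: the same codiagonal restriction is proved on the Summits side as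
`directSumTensor_restrictsTo_add` in `SoloInformedTriangularThreeUpper.lean`, which a Literature file
cannot import.) -/
private theorem tensorRestrictsTo_directSum_add (T₁ T₂ : ι → κ → μ → K) :
    TensorRestrictsTo (directSumTensor T₁ T₂) (T₁ + T₂) := by
  refine ⟨fun a' x => Sum.elim (fun a => if a = a' then 1 else 0) (fun a => if a = a' then 1 else 0) x,
    fun b' y => Sum.elim (fun b => if b = b' then 1 else 0) (fun b => if b = b' then 1 else 0) y,
    fun c' z => Sum.elim (fun c => if c = c' then 1 else 0) (fun c => if c = c' then 1 else 0) z,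
    fun a' b' c' => ?_⟩
  simp only [Fintype.sum_sum_type, Sum.elim_inl, Sum.elim_inr, directSumTensor_inl,
    directSumTensor_inr, directSumTensor_inl_inr, directSumTensor_inr_inl, mul_zero,
    Finset.sum_const_zero, add_zero, zero_add]
  have h₁ : ∀ (T : ι → κ → μ → K), (∑ a, ∑ b, ∑ c, (if a = a' then (1 : K) else 0) *
      (if b = b' then 1 else 0) * (if c = c' then 1 else 0) * T a b c) = T a' b' c' := by
    intro T
    rw [Finset.sum_eq_single a' (fun a _ ha => by simp [ha]) (by simp),
      Finset.sum_eq_single b' (fun b _ hb => by simp [hb]) (by simp),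
      Finset.sum_eq_single c' (fun c _ hc => by simp [hc]) (by simp)]
    simp
  have h₂ : (∑ a : ι, ∑ b : κ, ∑ c : μ, (if a = a' then (1 : K) else 0) *
      (if b = b' then 1 else 0) * (if c = c' then 1 else 0) *
        directSumTensor T₁ T₂ (Sum.inl a) (Sum.inl b) (Sum.inr c)) = 0 :=
    Finset.sum_eq_zero fun a _ => Finset.sum_eq_zero fun b _ => Finset.sum_eq_zero fun c _ => by
      simp [directSumTensor]
  have h₃ : (∑ a : ι, ∑ b : κ, ∑ c : μ, (if a = a' then (1 : K) else 0) *
      (if b = b' then 1 else 0) * (if c = c' then 1 else 0) *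
        directSumTensor T₁ T₂ (Sum.inr a) (Sum.inr b) (Sum.inl c)) = 0 :=
    Finset.sum_eq_zero fun a _ => Finset.sum_eq_zero fun b _ => Finset.sum_eq_zero fun c _ => by
      simp [directSumTensor]
  simp only [Finset.sum_add_distrib]
  rw [h₁ T₁, h₁ T₂, h₂, h₃, Pi.add_apply, Pi.add_apply, Pi.add_apply]
  ring

end SumLeDirectSum

namespace AlmanLi2026

section TwoGroups

variable {K : Type} [Field K] {ι' κ' μ' σ₁ σ₂ : Type} [Fintype ι'] [Fintype κ'] [Fintype μ']
  [Fintype σ₁] [Fintype σ₂] [DecidableEq ι'] [DecidableEq κ'] [DecidableEq μ']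

/-- Relabelling on the source side: `⟨r₁+r₂⟩ ⊕ (X ⊕ Y) ≥ (⟨r₁⟩ ⊕ X) ⊕ (⟨r₂⟩ ⊕ Y)` (equality of
classes in the tensor semiring). [cite: BurgisserClausenShokrollahi1997, Prop. (15.25)] -/
theorem tensorRestrictsTo_unit_add_shuffle {ιx κx μx ιy κy μy : Type} [Fintype ιx] [Fintype κx]
    [Fintype μx] [Fintype ιy] [Fintype κy] [Fintype μy] (r₁ r₂ : ℕ) (X : ιx → κx → μx → K)
    (Y : ιy → κy → μy → K) :
    TensorRestrictsTo (directSumTensor (unitTensor K (r₁ + r₂)) (directSumTensor X Y))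
      (directSumTensor (directSumTensor (unitTensor K r₁) X) (directSumTensor (unitTensor K r₂) Y)) := by
  have e : TensorClass.mk (directSumTensor (directSumTensor (unitTensor K r₁) X)
      (directSumTensor (unitTensor K r₂) Y)) =
      TensorClass.mk (directSumTensor (unitTensor K (r₁ + r₂)) (directSumTensor X Y)) := by
    simp only [← TensorClass.mk_add_mk, ← TensorClass.natCast_eq_mk, Nat.cast_add]
    ring
  exact (TensorClass.mk_eq_mk_iff.1 e).1

/-- Relabelling on the target side: `(T₁ ⊕ X) ⊕ (T₂ ⊕ Y) ≥ (T₁ ⊕ T₂) ⊕ (X ⊕ Y)`.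
[cite: BurgisserClausenShokrollahi1997, Prop. (15.25)] -/
theorem tensorRestrictsTo_add_add_shuffle {ι₁ κ₁ μ₁ ι₂ κ₂ μ₂ ιx κx μx ιy κy μy : Type}
    [Fintype ι₁] [Fintype κ₁] [Fintype μ₁] [Fintype ι₂] [Fintype κ₂] [Fintype μ₂] [Fintype ιx]
    [Fintype κx] [Fintype μx] [Fintype ιy] [Fintype κy] [Fintype μy] (T₁ : ι₁ → κ₁ → μ₁ → K)
    (T₂ : ι₂ → κ₂ → μ₂ → K) (X : ιx → κx → μx → K) (Y : ιy → κy → μy → K) :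
    TensorRestrictsTo (directSumTensor (directSumTensor T₁ X) (directSumTensor T₂ Y))
      (directSumTensor (directSumTensor T₁ T₂) (directSumTensor X Y)) := by
  have e : TensorClass.mk (directSumTensor (directSumTensor T₁ T₂) (directSumTensor X Y)) =
      TensorClass.mk (directSumTensor (directSumTensor T₁ X) (directSumTensor T₂ Y)) := by
    simp only [← TensorClass.mk_add_mk]
    ring
  exact (TensorClass.mk_eq_mk_iff.1 e).1

/-- **"Apply (thm:app-oneslice) to each `T_α` individually and sum the results"** — the combination
step of the first proof as a reusable lemma: from `⟨r₁⟩ ⊕ X₁ ⊵ T₁ ⊕ Y₁` and `⟨r₂⟩ ⊕ X₂ ⊵ T₂ ⊕ Y₂`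
with `T₁, T₂` of the same format, `⟨r₁+r₂⟩ ⊕ (X₁ ⊕ X₂) ⊵ (T₁ + T₂) ⊕ (Y₁ ⊕ Y₂)` (direct sum of the
two degenerations, relabelling, `T₁ + T₂ ≤ T₁ ⊕ T₂`). [cite: AlmanLi2026, Thm. 6.3 (first proof)] -/
theorem algDegeneratesTo_add_of_directSum {ιx κx μx ιy κy μy ιx' κx' μx' ιy' κy' μy' : Type}
    [Fintype ιx] [Fintype κx] [Fintype μx] [Fintype ιy] [Fintype κy] [Fintype μy] [Fintype ιx']
    [Fintype κx'] [Fintype μx'] [Fintype ιy'] [Fintype κy'] [Fintype μy']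
    {T₁ T₂ : ι' → κ' → μ' → K} {r₁ r₂ : ℕ} {X₁ : ιx → κx → μx → K} {X₂ : ιy → κy → μy → K}
    {Y₁ : ιx' → κx' → μx' → K} {Y₂ : ιy' → κy' → μy' → K}
    (h₁ : AlgDegeneratesTo (directSumTensor (unitTensor K r₁) X₁) (directSumTensor T₁ Y₁))
    (h₂ : AlgDegeneratesTo (directSumTensor (unitTensor K r₂) X₂) (directSumTensor T₂ Y₂)) :
    AlgDegeneratesTo (directSumTensor (unitTensor K (r₁ + r₂)) (directSumTensor X₁ X₂))
      (directSumTensor (T₁ + T₂) (directSumTensor Y₁ Y₂)) := by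
  classical
  have h := h₁.directSum h₂
  have hsrc := tensorRestrictsTo_unit_add_shuffle (K := K) r₁ r₂ X₁ X₂
  have htgt := (tensorRestrictsTo_add_add_shuffle (K := K) T₁ T₂ Y₁ Y₂).trans
    ((tensorRestrictsTo_directSum_add T₁ T₂).directSum (TensorRestrictsTo.refl _))
  exact (hsrc.algDegeneratesTo_trans h).trans_restrictsTo htgt

/-- **Alman–Li 2026, Thm. 6.3, `λ`-free case, two groups.** Let `T = ∑_{i ∈ σ₁ ⊔ σ₂} aᵢ ⊗ bᵢ ⊗ cᵢ`
(columns of `A, B, C₀`, indexed by `σ₁ ⊕ σ₂`; `n = |ι'|`, `m = |κ'|`), let `c'ᵢ ≠ 0`, and let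
`s_α ≥ rank (∑_{i ∈ σ_α} c'ᵢ aᵢ bᵢᵀ)` (`α = 1, 2`). Then
`⟨|σ₁|+|σ₂|⟩ ⊕ (⟨1,s₁,1⟩ ⊕ ⟨1,s₂,1⟩) ⊵ T ⊕ (⟨1, |σ₁|+s₁−(n+m), 1⟩ ⊕ ⟨1, |σ₂|+s₂−(n+m), 1⟩)`
(printed, `n × n × n`: `r_α + s_α − 2n`; slices with trivial factor third).  First printed proof:
Thm. 6.1 for `T₁`, `T₂` separately, direct sum, `T ≤ T₁ ⊕ T₂`.
[cite: AlmanLi2026, Thm. 6.3 (rank-decomposition case, first proof)] -/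
theorem thm63_rankDecomposition_two {T : ι' → κ' → μ' → K} {A : ι' → σ₁ ⊕ σ₂ → K}
    {B : κ' → σ₁ ⊕ σ₂ → K} {C₀ : μ' → σ₁ ⊕ σ₂ → K}
    (hT : ∀ a b c, T a b c = ∑ i, A a i * B b i * C₀ c i)
    {c' : σ₁ ⊕ σ₂ → K} (hc' : ∀ i, c' i ≠ 0) {s₁ s₂ : ℕ}
    (hM₁ : (Matrix.of fun a b => ∑ i : σ₁, A a (Sum.inl i) * B b (Sum.inl i) * c' (Sum.inl i)).rank
      ≤ s₁)
    (hM₂ : (Matrix.of fun a b => ∑ i : σ₂, A a (Sum.inr i) * B b (Sum.inr i) * c' (Sum.inr i)).rank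
      ≤ s₂) :
    AlgDegeneratesTo
      (directSumTensor (unitTensor K (Fintype.card σ₁ + Fintype.card σ₂))
        (directSumTensor (rotate (oneSliceTensor K (Fin s₁))) (rotate (oneSliceTensor K (Fin s₂)))))
      (directSumTensor T (directSumTensor
        (rotate (oneSliceTensor K (Fin (Fintype.card σ₁ + s₁ - (Fintype.card ι' + Fintype.card κ')))))
        (rotate (oneSliceTensor K
          (Fin (Fintype.card σ₂ + s₂ - (Fintype.card ι' + Fintype.card κ'))))))) := by
  classical
  -- `T = T₁ + T₂`
  set T₁ : ι' → κ' → μ' → K := fun a b c => ∑ i : σ₁, A a (Sum.inl i) * B b (Sum.inl i) *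
    C₀ c (Sum.inl i) with hT₁
  set T₂ : ι' → κ' → μ' → K := fun a b c => ∑ i : σ₂, A a (Sum.inr i) * B b (Sum.inr i) *
    C₀ c (Sum.inr i) with hT₂
  have hsum : T = T₁ + T₂ := by
    funext a b c
    rw [hT, Fintype.sum_sum_type, Pi.add_apply, Pi.add_apply, Pi.add_apply]
  -- Thm. 6.1 for each group
  have h₁ := thm61_rankDecomposition_fintype (K := K) (σ := σ₁) (T := T₁)
    (A := fun a i => A a (Sum.inl i)) (B := fun b i => B b (Sum.inl i))
    (C₀ := fun c i => C₀ c (Sum.inl i)) (fun a b c => rfl) (c' := fun i => c' (Sum.inl i))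
    (fun i => hc' _) hM₁
  have h₂ := thm61_rankDecomposition_fintype (K := K) (σ := σ₂) (T := T₂)
    (A := fun a i => A a (Sum.inr i)) (B := fun b i => B b (Sum.inr i))
    (C₀ := fun c i => C₀ c (Sum.inr i)) (fun a b c => rfl) (c' := fun i => c' (Sum.inr i))
    (fun i => hc' _) hM₂
  -- direct sum and relabellings
  rw [hsum]
  exact algDegeneratesTo_add_of_directSum h₁ h₂

end TwoGroups

/-! ## `p` groups of equal size: `T ⊕ p⊙⟨1,t,1⟩ ⊴ ⟨r⟩ ⊕ p⊙⟨1,s,1⟩` -/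

section Blocks

variable {K : Type} [Field K] {ι' κ' μ' σ₀ τ : Type} [Fintype ι'] [Fintype κ'] [Fintype μ']
  [Fintype σ₀] [Fintype τ] [DecidableEq ι'] [DecidableEq κ'] [DecidableEq μ']

/-- `p ⊙ X = ⟨p⟩ ⊠ X`: classes `↑p · [X]`; the two reshapings used in the induction step, as
restrictions. [cite: BurgisserClausenShokrollahi1997, Prop. (15.25)] -/
theorem tensorRestrictsTo_blocks_succ_source {ιx κx μx : Type} [Fintype ιx] [Fintype κx]
    [Fintype μx] (r₀ b p : ℕ) (X : ιx → κx → μx → K) :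
    TensorRestrictsTo
      (directSumTensor (unitTensor K (r₀ + (p + 1) * b)) (kroneckerTensor (unitTensor K (p + 1)) X))
      (directSumTensor (unitTensor K (r₀ + p * b + b))
        (directSumTensor (kroneckerTensor (unitTensor K p) X) X)) := by
  have e : TensorClass.mk (directSumTensor (unitTensor K (r₀ + p * b + b))
        (directSumTensor (kroneckerTensor (unitTensor K p) X) X)) =
      TensorClass.mk (directSumTensor (unitTensor K (r₀ + (p + 1) * b))
        (kroneckerTensor (unitTensor K (p + 1)) X)) := by
    simp only [← TensorClass.mk_add_mk, ← TensorClass.mk_mul_mk, ← TensorClass.natCast_eq_mk]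
    push_cast
    ring
  exact (TensorClass.mk_eq_mk_iff.1 e).1

omit [DecidableEq ι'] [DecidableEq κ'] [DecidableEq μ'] in
/-- Target-side reshaping `(T ⊕ (⟨p⟩⊠Y ⊕ Y)) ≥ T ⊕ ⟨p+1⟩⊠Y`. [cite: BurgisserClausenShokrollahi1997, Prop. (15.25)] -/
theorem tensorRestrictsTo_blocks_succ_target {ιy κy μy : Type} [Fintype ιy] [Fintype κy]
    [Fintype μy] (p : ℕ) (T : ι' → κ' → μ' → K) (Y : ιy → κy → μy → K) :
    TensorRestrictsTo (directSumTensor T (directSumTensor (kroneckerTensor (unitTensor K p) Y) Y))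
      (directSumTensor T (kroneckerTensor (unitTensor K (p + 1)) Y)) := by
  have e : TensorClass.mk (directSumTensor T (kroneckerTensor (unitTensor K (p + 1)) Y)) =
      TensorClass.mk (directSumTensor T (directSumTensor (kroneckerTensor (unitTensor K p) Y) Y)) := by
    simp only [← TensorClass.mk_add_mk, ← TensorClass.mk_mul_mk, ← TensorClass.natCast_eq_mk]
    push_cast
    ring
  exact (TensorClass.mk_eq_mk_iff.1 e).1

omit [DecidableEq ι'] [DecidableEq κ'] [DecidableEq μ'] in
/-- Base case plumbing: `⟨r⟩ ⊕ ⟨0⟩⊠X ≥ T ⊕ ⟨0⟩⊠Y` as soon as `⟨r⟩ ≥ T`. [cite: BurgisserClausenShokrollahi1997, Prop. (15.25)] -/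
theorem tensorRestrictsTo_blocks_zero {ιx κx μx ιy κy μy : Type} [Fintype ιx] [Fintype κx]
    [Fintype μx] [Fintype ιy] [Fintype κy] [Fintype μy] {r : ℕ} {T : ι' → κ' → μ' → K}
    (X : ιx → κx → μx → K) (Y : ιy → κy → μy → K) (h : TensorRestrictsTo (unitTensor K r) T) :
    TensorRestrictsTo (directSumTensor (unitTensor K r) (kroneckerTensor (unitTensor K 0) X))
      (directSumTensor T (kroneckerTensor (unitTensor K 0) Y)) := by
  have e₁ : TensorClass.mk (directSumTensor T (kroneckerTensor (unitTensor K 0) Y)) =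
      TensorClass.mk T := by
    rw [← TensorClass.mk_add_mk, ← TensorClass.mk_mul_mk, ← TensorClass.natCast_eq_mk]
    simp
  have e₂ : TensorClass.mk (directSumTensor (unitTensor K r) (kroneckerTensor (unitTensor K 0) X)) =
      TensorClass.mk (unitTensor K r) := by
    rw [← TensorClass.mk_add_mk, ← TensorClass.mk_mul_mk, ← TensorClass.natCast_eq_mk 0]
    simp
  have hle : TensorClass.mk T ≤ TensorClass.mk (unitTensor K r) := TensorClass.mk_le_mk_iff.2 h
  rw [← e₁, ← e₂] at hle
  exact TensorClass.mk_le_mk_iff.1 hle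

/-- **Alman–Li 2026, Thm. 6.3, `λ`-free case, `p` groups of one size** (the form used after
Remark-free display p0016 L57–60: `T ⊕ p⊙⟨1,2n,1⟩ ⊴ ⟨r⟩ ⊕ p⊙⟨1,n,1⟩`): let `T` have a rank
decomposition indexed by `σ₀ ⊔ (Fin p × τ)` (`p` groups `{α} × τ` of size `b = |τ|`, and a remainder
`σ₀` that receives no slice), nonzero scalars `c'` on the groups, and `s ≥ rank M_α` for every group.
Then `⟨|σ₀| + p·b⟩ ⊕ p⊙⟨1,s,1⟩ ⊵ T ⊕ p⊙⟨1, b + s − (n+m), 1⟩` (`p⊙X = ⟨p⟩ ⊠ X`; slices with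
trivial factor third). Proof: induction on `p` — Thm. 6.1 for the last group, the induction
hypothesis for the rest, `algDegeneratesTo_add_of_directSum`.
[cite: AlmanLi2026, Thm. 6.3 (rank-decomposition case, first proof)] -/
theorem thm63_rankDecomposition_blocks :
    ∀ (p : ℕ) {T : ι' → κ' → μ' → K} {A : ι' → σ₀ ⊕ (Fin p × τ) → K}
      {B : κ' → σ₀ ⊕ (Fin p × τ) → K} {C₀ : μ' → σ₀ ⊕ (Fin p × τ) → K}
      (_hT : ∀ a b c, T a b c = ∑ i, A a i * B b i * C₀ c i) {c' : Fin p × τ → K}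
      (_hc' : ∀ x, c' x ≠ 0) {s : ℕ}
      (_hM : ∀ α : Fin p, (Matrix.of fun a b => ∑ j : τ,
        A a (Sum.inr (α, j)) * B b (Sum.inr (α, j)) * c' (α, j)).rank ≤ s),
      AlgDegeneratesTo
        (directSumTensor (unitTensor K (Fintype.card σ₀ + p * Fintype.card τ))
          (kroneckerTensor (unitTensor K p) (rotate (oneSliceTensor K (Fin s)))))
        (directSumTensor T (kroneckerTensor (unitTensor K p) (rotate (oneSliceTensor K
          (Fin (Fintype.card τ + s - (Fintype.card ι' + Fintype.card κ'))))))) := by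
  classical
  intro p
  induction p with
  | zero =>
    intro T A B C₀ hT c' hc' s hM
    -- `T ≤ ⟨|σ₀| + 0·b⟩`
    have hrank : tensorRank T ≤ Fintype.card σ₀ + 0 * Fintype.card τ := by
      have hcard : Fintype.card (σ₀ ⊕ (Fin 0 × τ)) = Fintype.card σ₀ + 0 * Fintype.card τ := by
        simp [Fintype.card_sum]
      rw [← hcard]
      refine tensorRank_le_card_of_eq_sum (fun i a => A a i) (fun i b => B b i) (fun i c => C₀ c i) ?_
      funext a b c
      rw [hT]
      simp [Finset.sum_apply, triad_apply]
    exact (tensorRestrictsTo_blocks_zero _ _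
      (tensorRestrictsTo_unitTensor_of_tensorRank_le T hrank)).algDegeneratesTo
  | succ p ih =>
    intro T A B C₀ hT c' hc' s hM
    -- split off the last group: `T = T_rest + T_last`
    set Ar : ι' → σ₀ ⊕ (Fin p × τ) → K := fun a i => A a (Sum.map id (Prod.map Fin.castSucc id) i)
      with hAr
    set Br : κ' → σ₀ ⊕ (Fin p × τ) → K := fun b i => B b (Sum.map id (Prod.map Fin.castSucc id) i)
      with hBr
    set Cr : μ' → σ₀ ⊕ (Fin p × τ) → K := fun c i => C₀ c (Sum.map id (Prod.map Fin.castSucc id) i)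
      with hCr
    set Tr : ι' → κ' → μ' → K := fun a b c => ∑ i, Ar a i * Br b i * Cr c i with hTr
    set Tl : ι' → κ' → μ' → K := fun a b c => ∑ j : τ, A a (Sum.inr (Fin.last p, j)) *
      B b (Sum.inr (Fin.last p, j)) * C₀ c (Sum.inr (Fin.last p, j)) with hTl
    have hsplit : T = Tr + Tl := by
      funext a b c
      simp only [Pi.add_apply, hT, hTr, hTl, hAr, hBr, hCr, Fintype.sum_sum_type,
        Fintype.sum_prod_type, Sum.map_inl, Sum.map_inr, id_eq, Prod.map_apply]
      rw [Fin.sum_univ_castSucc]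
      ring
    -- induction hypothesis for the rest, Thm. 6.1 for the last group
    have hrest := ih (T := Tr) (A := Ar) (B := Br) (C₀ := Cr) (fun a b c => rfl)
      (c' := fun x => c' (Fin.castSucc x.1, x.2)) (fun x => hc' _) (s := s) (fun α => by
        have h := hM (Fin.castSucc α)
        simpa [hAr, hBr] using h)
    have hlast := thm61_rankDecomposition_fintype (K := K) (σ := τ) (T := Tl)
      (A := fun a j => A a (Sum.inr (Fin.last p, j))) (B := fun b j => B b (Sum.inr (Fin.last p, j)))
      (C₀ := fun c j => C₀ c (Sum.inr (Fin.last p, j))) (fun a b c => rfl)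
      (c' := fun j => c' (Fin.last p, j)) (fun j => hc' _) (hM (Fin.last p))
    have hcomb := algDegeneratesTo_add_of_directSum hrest hlast
    rw [hsplit]
    exact ((tensorRestrictsTo_blocks_succ_source _ _ _ _).algDegeneratesTo_trans hcomb).trans_restrictsTo
      (tensorRestrictsTo_blocks_succ_target _ _ _)

end Blocks

end AlmanLi2026

end Literature.Computability.AlgebraicComplexity
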